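import Literature.IUT.LogVolume.TensorPacketLicenceCellOrders
import Literature.IUT.LogVolume.TensorPacketShellHull
import Summits.ABC.IUTFork.Cor312ThetaSideOrbitHullM
import HarnessLib

/-!
# IUT REPAIR branch → R-H (D-0079), door «G2-CREDIT±» part 3 — COLUMN FAITHFULNESS at the diagonal packet of ONE local field:
# the cell slack in INTEGER ORDERS is `(log p/e)·marg`, `marg := m_q − [e·⌊(M − (|I|−1)·D − |I|·R_in)/e⌋ + |I|·R_out]` (the R-W integer)

PROOF-ONLY sequel (D-0012: 0 definitions, 0 `Prop` facts, no instance) of `Repair/RHCellSlackExact` (p481438) and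
`Repair/RHCellSlackExactStatement` (p482070), abc-iut cell, rung LADDER-ABC:A2.RESCUE.H, seat abc-iut-rh-typ-4 (gen 4). TAKES NO SIDE on
[IUTchIII] Cor. 3.12 (S. Mochizuki, *Inter-universal Teichmüller theory III*, kurims manuscript, Cor. 3.12 p. 173–175; Thm. 3.11 (i)
(Ind1)(Ind2) p. 154; [IUTchIV] Prop. 1.1 p. 9, Prop. 1.2 (i)(ii) p. 10) or on any author: classical lattice arithmetic over the cell's REAL
definitions (`PacketAlgebra`, `normalizedPacket = (R_I)^∼`, `logPacket = log_p(R_I^×)`, `packetHull`, `indTwo` = Dupuy–Hilado's full (Ind2),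
`packetLogμ = log μ̄`). typed ≠ proved for anything not named as a theorem; instantiated ≠ endorsed.

WHY (caveat (b) «column faithfulness» of HOME/abc-iut-rh-typ-4/G2-CREDIT-RULING.md). Part 1 writes the cell slack of a packet as
`Σ_{v⃗} Pr(v⃗)·(−m(v⃗)·log p + Σ_a log‖c^out(v_a)‖ − log‖t_{q,v_j}‖)` with an ABSTRACT exact content `m(v⃗)` (binders `hm0`/`hm1`). The R-H /
R-W tables carry INTEGERS per place: `e = e(K_w/ℚ_p)`, the different exponent `D` (`d_K = D/e`), the inner radius `R_in` (`‖c_in‖ = ‖ϖ‖^{R_in}`,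
largest ball in `log_p(𝒪^×)`), the outer radius `R_out` (`‖c_out‖ = ‖ϖ‖^{R_out}`, largest norm on `log_p(𝒪^×)`), the Θ-depth `M` and the
q-depth `m_q`; abc-iut-w5-d180's `iota_smul_subset_packetHull_orbit_iota_smul_iff_orders` (`TensorPacketLicenceCellOrders`) decides the licence
cell there as `e·⌊(M − (|I|−1)·D − |I|·R_in)/e⌋ + |I|·R_out ≤ m_q`. THIS file computes, at the same DIAGONAL packet (all `|I|` slots the one field
`K`, all Θ-slots of depth `M` — the (Ind1)-symmetric slot union of the sharp setting at a Galois fibre), the EXACT CONTENT and the SLACK in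
the same integers:

* §1 `zpow_mul_norm_zpow_le_diag_iff` (real ↔ integer bookkeeping, abc-iut-w5-d180's `hL` made a lemma);
  `slotUnion_diag_subset_zpow_smul_logPacket_iff` — `⋃_a ι_a(x_a)·(R_I)^∼ ⊆ p^m·log_p(R_I^×) ⟺ m·e ≤ M − (|I|−1)·D − |I|·R_in`
  (abc-iut-c312-5 `iota_smul_normalizedPacket_subset_zpow_smul_logPacket_iff` slot by slot + abc-iut-w5-d180 §1–§2);
  **`content_slotUnion_diag_orders`** — the exact content is `m⋆ := ⌊(M − (|I|−1)·D − |I|·R_in)/e⌋` (the pair `hm0`/`hm1` of part 1, CONSTRUCTED).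
* §2 **`cellSlack_diag_orders`** — `log μ̄(hull(Ind2·⋃_a ι_a(x_a)·(R_I)^∼)) − log μ̄(ι_{b'}(t_q)·(R_I)^∼) = ((m_q − e·m⋆ − |I|·R_out)/e)·log p`
  (abc-iut-w5-d180 `Cor312Vol.packetLogμ_packetHull_orbit_slotUnion_eq` + abc-iut-c312-5 `packetLogμ_packetHull_logPacket_eq_sum` +
  `packetLogμ_iota_smul_normalizedPacket`, `‖ϖ‖ = p^{−1/e}`): THE BRACKET OF PART 1 IS `(log p/e)·marg` with the table's integer
  `marg = m_q − [e·m⋆ + |I|·R_out]`.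
* §3 `cellSlack_diag_nonneg_iff_orders` — `0 ≤ slack ⟺ e·m⋆ + |I|·R_out ≤ m_q`; **`cellSlack_diag_nonneg_iff_licence`** — `0 ≤ slack ⟺` the
  summand's (xi-f) inclusion `ι_{b'}(t_q)·(R_I)^∼ ⊆ hull(Ind2·ι_b(x_b)·(R_I)^∼)` (abc-iut-w5-d180's orders form of abc-iut-c312-5's cell): the SIGN of
  the slack is the licence cell, its SIZE is the margin — «room», not «membership only», in integers.

HONEST SCOPE. One diagonal packet of one field with prescribed integer data; which genuine completion carries which `(e, D, R_in, R_out)`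
(abc-iut-c312-3 `UnitLogMaxNorm` / `UnitLogValuationSpectrum.innerRadius_closedForm`, abc-iut-w4-d087's local types) and the Galois descent
of a packet sum to places (abc-iut-s2 `Cor312ThetaSideGaloisDescent`) are NOT re-done here. Nothing here decides any cell at genuine data,
asserts or denies Cor. 3.12, or bears on abc. [claim: Mochizuki2012, status: disputed] for every quoted construction; [cite: DupuyHilado2025,
§3.7, §4.9, §4.12]; [cite: Mochizuki2012, IUTchIV Prop. 1.1 p. 9, Prop. 1.2 (i)(ii) p. 10, Prop. 1.4 (iii) p. 13–14]; [cite: NeukirchANT1999,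
Ch. II (5.5)]. Axioms: standard.
-/

noncomputable section

open Set Function
open scoped Pointwise

namespace Summit.ABC.IUTFork.Repair.RHCellSlackExactOrders

open Literature.IUT.LogVolume Literature.NumberTheory.GaloisRepresentations.Ultrametric Summit.ABC.IUTFork.Cor312Vol

variable (p : ℕ) [Fact p.Prime] {I : Type} [Fintype I] [DecidableEq I] [Nonempty I]
  {K : Type} [NontriviallyNormedField K] [NormedAlgebra ℚ_[p] K] [IsUltrametricDist K] [ProperSpace K]

/-! ## §1. The exact content of the diagonal slot union, in integer orders -/

omit [DecidableEq I] in
/-- Real ↔ integer bookkeeping (abc-iut-w5-d180's `hL`): with `‖ϖ‖ = p^{−1/e}` and `d_K = D/e`,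
`p^m·‖ϖ‖^M ≤ p^{−(|I|−1)·d_K}·(‖ϖ‖^{R_in})^{|I|} ⟺ m·e ≤ M − (|I|−1)·D − |I|·R_in`. [cite: NeukirchANT1999, Ch. II (5.5)] -/
theorem zpow_mul_norm_zpow_le_diag_iff {ϖ : Kˣ} (hϖ : IsUniformizer ϖ) {D : ℕ}
    (hD : differentOrd p K = (D : ℝ) / absRamificationIdx p K) (m M Rin : ℤ) :
    ((p : ℝ) ^ m * ‖(ϖ : K)‖ ^ M ≤
        (p : ℝ) ^ (-(((Fintype.card I : ℝ) - 1) * differentOrd p K)) * (‖(ϖ : K)‖ ^ Rin) ^ Fintype.card I) ↔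
      m * (absRamificationIdx p K : ℤ) ≤ M - (Fintype.card I - 1 : ℕ) * (D : ℤ) - Fintype.card I * Rin := by
  have hcard : 1 ≤ Fintype.card I := Fintype.card_pos
  rw [zpow_mul_norm_zpow_le_iff p hϖ m M Rin (((Fintype.card I : ℝ) - 1) * differentOrd p K) (Fintype.card I), hD]
  have he : (absRamificationIdx p K : ℝ) ≠ 0 := by exact_mod_cast (absRamificationIdx_pos p K).ne'
  have h1 : -(((Fintype.card I : ℝ) - 1) * ((D : ℝ) / absRamificationIdx p K)) * absRamificationIdx p K =
      -(((Fintype.card I : ℝ) - 1) * D) := by field_simp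
  rw [h1]
  constructor
  · intro h
    have h' : ((m * (absRamificationIdx p K : ℤ) : ℤ) : ℝ) ≤
        ((M - (Fintype.card I - 1 : ℕ) * (D : ℤ) - Fintype.card I * Rin : ℤ) : ℝ) := by
      push_cast; rw [Nat.cast_sub hcard]; push_cast; linarith
    exact_mod_cast h'
  · intro h
    have h' : ((m * (absRamificationIdx p K : ℤ) : ℤ) : ℝ) ≤
        ((M - (Fintype.card I - 1 : ℕ) * (D : ℤ) - Fintype.card I * Rin : ℤ) : ℝ) := by exact_mod_cast h
    push_cast at h'; rw [Nat.cast_sub hcard] at h'; push_cast at h'; linarith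

/-- **Admissible contents of the diagonal slot union, in integers**: for the constant family `k_a = K`, the largest inner ball
`c_in·𝒪 ⊆ log_p(𝒪^×)` of radius `‖ϖ‖^{R_in}`, different exponent `D`, and slot scalars `x_a` all of norm `‖ϖ‖^M`:
`⋃_a ι_a(x_a)·(R_I)^∼ ⊆ p^m·log_p(R_I^×) ⟺ m·e ≤ M − (|I|−1)·D − |I|·R_in` (abc-iut-c312-5's content of a slot box, slot by slot — it does
not depend on the slot —, the `∀ J` collapsed at the least factor different `= (|I|−1)·d_K`). [cite: Mochizuki2012, IUTchIV Prop. 1.2 (ii) p. 10]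
[cite: DupuyHilado2025, §4.9, §4.12] -/
theorem slotUnion_diag_subset_zpow_smul_logPacket_iff {ϖ : Kˣ} (hϖ : IsUniformizer ϖ) {D : ℕ}
    (hD : differentOrd p K = (D : ℝ) / absRamificationIdx p K) {cin : K}
    (hin : ∀ o : K, ‖o‖ ≤ 1 → cin * o ∈ logUnits K)
    (hmax : ∃ (ϖ' : Kˣ) (w : K), IsUniformizer ϖ' ∧ w ∉ logUnits K ∧ ‖w‖ * ‖(ϖ' : K)‖ ≤ ‖cin‖)
    {Rin : ℤ} (hRin : ‖cin‖ = ‖(ϖ : K)‖ ^ Rin) {x : I → K} {M : ℤ} (hx : ∀ a, ‖x a‖ = ‖(ϖ : K)‖ ^ M) (m : ℤ) :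
    (⋃ a, iota p (fun _ : I => K) a (x a) • (normalizedPacket p (fun _ : I => K) : Set (PacketAlgebra p (fun _ : I => K)))) ⊆
        ((p : ℚ_[p]) ^ m) • (logPacket p (fun _ : I => K) : Set (PacketAlgebra p (fun _ : I => K))) ↔
      m * (absRamificationIdx p K : ℤ) ≤ M - (Fintype.card I - 1 : ℕ) * (D : ℤ) - Fintype.card I * Rin := by
  have hϖ0 : 0 < ‖(ϖ : K)‖ := norm_pos_iff.2 ϖ.ne_zero
  have hcin0 : cin ≠ 0 := by
    rw [← norm_pos_iff, hRin]; exact zpow_pos hϖ0 _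
  have key : ∀ a : I,
      iota p (fun _ : I => K) a (x a) • (normalizedPacket p (fun _ : I => K) : Set (PacketAlgebra p (fun _ : I => K))) ⊆
          ((p : ℚ_[p]) ^ m) • (logPacket p (fun _ : I => K) : Set (PacketAlgebra p (fun _ : I => K))) ↔
        m * (absRamificationIdx p K : ℤ) ≤ M - (Fintype.card I - 1 : ℕ) * (D : ℤ) - Fintype.card I * Rin := by
    intro a
    rw [iota_smul_normalizedPacket_subset_zpow_smul_logPacket_iff p (fun _ : I => K) (c := fun _ => cin) (fun _ => hcin0)
      (fun _ => hin) (fun _ => hmax) a (x a) m,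
      forall_dFac_le_rpow_mul_iff_inf p (fun _ : I => K) (Finset.prod_nonneg fun i _ => norm_nonneg _),
      dSum_sub_inf_differentOrd_dFac_const p K]
    simp only [Finset.prod_const, Finset.card_univ, hx, hRin]
    exact zpow_mul_norm_zpow_le_diag_iff p (I := I) hϖ hD m M Rin
  rw [Set.iUnion_subset_iff]
  obtain ⟨a₀⟩ := ‹Nonempty I›
  exact ⟨fun h => (key a₀).mp (h a₀), fun h a => (key a).mpr h⟩

/-- **THE EXACT CONTENT OF THE DIAGONAL SLOT UNION IS `m⋆ = ⌊(M − (|I|−1)·D − |I|·R_in)/e⌋`** (`/` the `Int` floor division): the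
union lies in `p^{m⋆}·log_p(R_I^×)` and not in `p^{m⋆+1}·log_p(R_I^×)` — part 1's binder pair `hm0`/`hm1`, CONSTRUCTED from the table's
integers. [cite: Mochizuki2012, IUTchIV Prop. 1.2 (ii) p. 10] [cite: DupuyHilado2025, §4.12] -/
theorem content_slotUnion_diag_orders {ϖ : Kˣ} (hϖ : IsUniformizer ϖ) {D : ℕ}
    (hD : differentOrd p K = (D : ℝ) / absRamificationIdx p K) {cin : K}
    (hin : ∀ o : K, ‖o‖ ≤ 1 → cin * o ∈ logUnits K)
    (hmax : ∃ (ϖ' : Kˣ) (w : K), IsUniformizer ϖ' ∧ w ∉ logUnits K ∧ ‖w‖ * ‖(ϖ' : K)‖ ≤ ‖cin‖)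
    {Rin : ℤ} (hRin : ‖cin‖ = ‖(ϖ : K)‖ ^ Rin) {x : I → K} {M : ℤ} (hx : ∀ a, ‖x a‖ = ‖(ϖ : K)‖ ^ M) :
    (⋃ a, iota p (fun _ : I => K) a (x a) • (normalizedPacket p (fun _ : I => K) : Set (PacketAlgebra p (fun _ : I => K)))) ⊆
        ((p : ℚ_[p]) ^ ((M - (Fintype.card I - 1 : ℕ) * (D : ℤ) - Fintype.card I * Rin) / absRamificationIdx p K)) •
          (logPacket p (fun _ : I => K) : Set (PacketAlgebra p (fun _ : I => K))) ∧
      ¬ (⋃ a, iota p (fun _ : I => K) a (x a) • (normalizedPacket p (fun _ : I => K) : Set (PacketAlgebra p (fun _ : I => K)))) ⊆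
        ((p : ℚ_[p]) ^ ((M - (Fintype.card I - 1 : ℕ) * (D : ℤ) - Fintype.card I * Rin) / absRamificationIdx p K + 1)) •
          (logPacket p (fun _ : I => K) : Set (PacketAlgebra p (fun _ : I => K))) := by
  have he0 : (0 : ℤ) < absRamificationIdx p K := by exact_mod_cast absRamificationIdx_pos p K
  refine ⟨(slotUnion_diag_subset_zpow_smul_logPacket_iff p hϖ hD hin hmax hRin hx _).mpr (Int.ediv_mul_le _ he0.ne'), fun h => ?_⟩
  have h' := (slotUnion_diag_subset_zpow_smul_logPacket_iff p hϖ hD hin hmax hRin hx _).mp h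
  have h'' := Int.le_ediv_of_mul_le he0 h'
  linarith

/-! ## §2. The cell slack of the diagonal packet in integer orders -/

/-- `log ‖ϖ‖ = −(1/e)·log p` for a norm uniformiser. [cite: NeukirchANT1999, Ch. II (5.5)] -/
theorem log_norm_uniformizer {ϖ : Kˣ} (hϖ : IsUniformizer ϖ) :
    Real.log ‖(ϖ : K)‖ = -(1 / (absRamificationIdx p K : ℝ)) * Real.log p := by
  have hp0 : (0 : ℝ) < p := by exact_mod_cast (Fact.out : p.Prime).pos
  rw [norm_eq_rpow_of_isUniformizer p K hϖ, Real.log_rpow hp0]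

/-- **THE CELL SLACK AT THE DIAGONAL PACKET OF ONE FIELD, IN INTEGER ORDERS (column faithfulness).** Norm uniformiser `ϖ`,
`e = e(K/ℚ_p)`, different exponent `D`, inner radius `‖c_in‖ = ‖ϖ‖^{R_in}`, outer radius `‖c_out‖ = ‖ϖ‖^{R_out}` (largest norm on
`log_p(𝒪_K^×)`), Θ-slot scalars all of norm `‖ϖ‖^M`, `‖t_q‖ = ‖ϖ‖^{m_q}`. Then
`log μ̄(hull(⋃_{g∈Ind2} g·⋃_a ι_a(x_a)·(R_I)^∼)) − log μ̄(ι_{b'}(t_q)·(R_I)^∼) = ((m_q − e·m⋆ − |I|·R_out)/e)·log p`, `m⋆ = ⌊(M − (|I|−1)·D − |I|·R_in)/e⌋`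
— part 1's bracket `−m·log p + Σ_a log‖c^out‖ − log‖t_q‖` IS `(log p/e)·marg` with the R-W table's integer
`marg = m_q − [e·⌊(M − (|I|−1)·D − |I|·R_in)/e⌋ + |I|·R_out]` (at a label `j`: `|I| = j+1`, `M = j²·m_q`).
[cite: DupuyHilado2025, §3.7, §4.9, §4.12] [cite: Mochizuki2012, IUTchIV Prop. 1.2 (i)(ii) p. 10, Prop. 1.4 (iii) p. 13–14] [claim: Mochizuki2012, status: disputed] -/
theorem cellSlack_diag_orders {ϖ : Kˣ} (hϖ : IsUniformizer ϖ) {D : ℕ}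
    (hD : differentOrd p K = (D : ℝ) / absRamificationIdx p K) {cin cout : K}
    (hin : ∀ o : K, ‖o‖ ≤ 1 → cin * o ∈ logUnits K)
    (hmax : ∃ (ϖ' : Kˣ) (w : K), IsUniformizer ϖ' ∧ w ∉ logUnits K ∧ ‖w‖ * ‖(ϖ' : K)‖ ≤ ‖cin‖)
    (houtΛ : cout ∈ logUnits K) (hdom : ∀ z ∈ logUnits K, ‖z‖ ≤ ‖cout‖)
    {Rin Rout : ℤ} (hRin : ‖cin‖ = ‖(ϖ : K)‖ ^ Rin) (hRout : ‖cout‖ = ‖(ϖ : K)‖ ^ Rout)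
    {x : I → K} {M : ℤ} (hx : ∀ a, ‖x a‖ = ‖(ϖ : K)‖ ^ M) (b' : I) {tq : K} {mq : ℤ} (hq : ‖tq‖ = ‖(ϖ : K)‖ ^ mq) :
    packetLogμ p (fun _ : I => K) (packetHull p (fun _ : I => K) (⋃ g : indTwo p (fun _ : I => K),
          g • ⋃ a, iota p (fun _ : I => K) a (x a) • (normalizedPacket p (fun _ : I => K) : Set (PacketAlgebra p (fun _ : I => K))))) -
        packetLogμ p (fun _ : I => K)
          (iota p (fun _ : I => K) b' tq • (normalizedPacket p (fun _ : I => K) : Set (PacketAlgebra p (fun _ : I => K)))) =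
      ((mq - (absRamificationIdx p K : ℤ) * ((M - (Fintype.card I - 1 : ℕ) * (D : ℤ) - Fintype.card I * Rin) / absRamificationIdx p K) -
          Fintype.card I * Rout : ℤ) : ℝ) / absRamificationIdx p K * Real.log p := by
  have hϖ0 : 0 < ‖(ϖ : K)‖ := norm_pos_iff.2 ϖ.ne_zero
  have htq0 : tq ≠ 0 := by
    rw [← norm_pos_iff, hq]; exact zpow_pos hϖ0 _
  have he : (absRamificationIdx p K : ℝ) ≠ 0 := by exact_mod_cast (absRamificationIdx_pos p K).ne'
  obtain ⟨hm0, hm1⟩ := content_slotUnion_diag_orders p hϖ hD hin hmax hRin hx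
  rw [packetLogμ_packetHull_orbit_slotUnion_eq p (fun _ : I => K) x hm0 hm1,
    packetLogμ_packetHull_logPacket_eq_sum p (fun _ : I => K) (z := fun _ => cout) (fun _ => houtΛ) (fun _ => hdom),
    packetLogμ_iota_smul_normalizedPacket p (fun _ : I => K) b' htq0]
  simp only [Finset.sum_const, Finset.card_univ, nsmul_eq_mul, hRout, hq, Real.log_zpow, log_norm_uniformizer p hϖ]
  push_cast
  field_simp
  ring

/-! ## §3. The sign of the slack is the licence cell; its size is the margin -/

/-- **`0 ≤ slack ⟺ e·m⋆ + |I|·R_out ≤ m_q`** (`log p > 0`, `e > 0`). [cite: DupuyHilado2025, §4.12] [claim: Mochizuki2012, status: disputed] -/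
theorem cellSlack_diag_nonneg_iff_orders {ϖ : Kˣ} (hϖ : IsUniformizer ϖ) {D : ℕ}
    (hD : differentOrd p K = (D : ℝ) / absRamificationIdx p K) {cin cout : K}
    (hin : ∀ o : K, ‖o‖ ≤ 1 → cin * o ∈ logUnits K)
    (hmax : ∃ (ϖ' : Kˣ) (w : K), IsUniformizer ϖ' ∧ w ∉ logUnits K ∧ ‖w‖ * ‖(ϖ' : K)‖ ≤ ‖cin‖)
    (houtΛ : cout ∈ logUnits K) (hdom : ∀ z ∈ logUnits K, ‖z‖ ≤ ‖cout‖)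
    {Rin Rout : ℤ} (hRin : ‖cin‖ = ‖(ϖ : K)‖ ^ Rin) (hRout : ‖cout‖ = ‖(ϖ : K)‖ ^ Rout)
    {x : I → K} {M : ℤ} (hx : ∀ a, ‖x a‖ = ‖(ϖ : K)‖ ^ M) (b' : I) {tq : K} {mq : ℤ} (hq : ‖tq‖ = ‖(ϖ : K)‖ ^ mq) :
    0 ≤ packetLogμ p (fun _ : I => K) (packetHull p (fun _ : I => K) (⋃ g : indTwo p (fun _ : I => K),
            g • ⋃ a, iota p (fun _ : I => K) a (x a) • (normalizedPacket p (fun _ : I => K) : Set (PacketAlgebra p (fun _ : I => K))))) -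
          packetLogμ p (fun _ : I => K)
            (iota p (fun _ : I => K) b' tq • (normalizedPacket p (fun _ : I => K) : Set (PacketAlgebra p (fun _ : I => K)))) ↔
      (absRamificationIdx p K : ℤ) * ((M - (Fintype.card I - 1 : ℕ) * (D : ℤ) - Fintype.card I * Rin) / absRamificationIdx p K) +
          Fintype.card I * Rout ≤ mq := by
  have hp1 : (1 : ℝ) < p := by exact_mod_cast (Fact.out : p.Prime).one_lt
  have hlog : 0 < Real.log p := Real.log_pos hp1
  have he : (0 : ℝ) < absRamificationIdx p K := by exact_mod_cast absRamificationIdx_pos p K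
  rw [cellSlack_diag_orders p hϖ hD hin hmax houtΛ hdom hRin hRout hx b' hq]
  have hiff : ∀ z : ℤ, (0 : ℝ) ≤ ((z : ℤ) : ℝ) / (absRamificationIdx p K : ℝ) * Real.log p ↔ 0 ≤ z := fun z => by
    constructor
    · intro h
      by_contra hneg
      push Not at hneg
      have hz : ((z : ℤ) : ℝ) < 0 := by exact_mod_cast hneg
      have : ((z : ℤ) : ℝ) / (absRamificationIdx p K : ℝ) * Real.log p < 0 :=
        mul_neg_of_neg_of_pos (div_neg_of_neg_of_pos hz he) hlog
      linarith
    · intro h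
      have hz : (0 : ℝ) ≤ ((z : ℤ) : ℝ) := by exact_mod_cast h
      exact mul_nonneg (div_nonneg hz he.le) hlog.le
  rw [hiff]
  constructor <;> intro h <;> linarith

/-- **THE SIGN OF THE SLACK IS THE LICENCE CELL** (and its size the margin): `0 ≤ slack ⟺ ι_{b'}(t_q)·(R_I)^∼ ⊆ hull(⋃_{g∈Ind2} g·ι_b(x_b)·(R_I)^∼)`
— §3 with abc-iut-w5-d180's INTEGER ORDERS form of abc-iut-c312-5's exact per-summand (xi-f) cell
(`iota_smul_subset_packetHull_orbit_iota_smul_iff_orders`). A realised cell with margin `r` has slack EXACTLY `(log p/e)·r`: «room», not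
«membership only». [cite: DupuyHilado2025, §4.9, §4.12] [cite: Mochizuki2012, IUTchIV Prop. 1.1 p. 9, Prop. 1.2 (i)(ii) p. 10] [claim: Mochizuki2012, status: disputed] -/
theorem cellSlack_diag_nonneg_iff_licence {ϖ : Kˣ} (hϖ : IsUniformizer ϖ) {D : ℕ}
    (hD : differentOrd p K = (D : ℝ) / absRamificationIdx p K) {cin cout : K}
    (hin : ∀ o : K, ‖o‖ ≤ 1 → cin * o ∈ logUnits K)
    (hmax : ∃ (ϖ' : Kˣ) (w : K), IsUniformizer ϖ' ∧ w ∉ logUnits K ∧ ‖w‖ * ‖(ϖ' : K)‖ ≤ ‖cin‖)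
    (houtΛ : cout ∈ logUnits K) (hdom : ∀ z ∈ logUnits K, ‖z‖ ≤ ‖cout‖)
    {Rin Rout : ℤ} (hRin : ‖cin‖ = ‖(ϖ : K)‖ ^ Rin) (hRout : ‖cout‖ = ‖(ϖ : K)‖ ^ Rout)
    {x : I → K} {M : ℤ} (hx : ∀ a, ‖x a‖ = ‖(ϖ : K)‖ ^ M) (b b' : I) {tq : K} {mq : ℤ} (hq : ‖tq‖ = ‖(ϖ : K)‖ ^ mq) :
    0 ≤ packetLogμ p (fun _ : I => K) (packetHull p (fun _ : I => K) (⋃ g : indTwo p (fun _ : I => K),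
            g • ⋃ a, iota p (fun _ : I => K) a (x a) • (normalizedPacket p (fun _ : I => K) : Set (PacketAlgebra p (fun _ : I => K))))) -
          packetLogμ p (fun _ : I => K)
            (iota p (fun _ : I => K) b' tq • (normalizedPacket p (fun _ : I => K) : Set (PacketAlgebra p (fun _ : I => K)))) ↔
      iota p (fun _ : I => K) b' tq • (normalizedPacket p (fun _ : I => K) : Set (PacketAlgebra p (fun _ : I => K))) ⊆
        packetHull p (fun _ : I => K) (⋃ g : indTwo p (fun _ : I => K),
          g • (iota p (fun _ : I => K) b (x b) • (normalizedPacket p (fun _ : I => K) : Set (PacketAlgebra p (fun _ : I => K))))) := by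
  rw [cellSlack_diag_nonneg_iff_orders p hϖ hD hin hmax houtΛ hdom hRin hRout hx b' hq,
    iota_smul_subset_packetHull_orbit_iota_smul_iff_orders p hϖ hD hin hmax houtΛ hdom hRin hRout b b' (hx b) hq]

end Summit.ABC.IUTFork.Repair.RHCellSlackExactOrders

end
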